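import Mathlib
import HarnessLib
import Summits.AtomisticToContinuum.FouriersLaw.Theses.JunctionLocality
import Literature.MathematicalPhysics.KineticTheory.LangevinChainNESSHolds
import Summits.AtomisticToContinuum.FouriersLaw.Theorems.JunctionLocalitySuperadditiveResistanceStubLinearResponsePlain
import Summits.AtomisticToContinuum.FouriersLaw.Theorems.JunctionLocalitySuperadditiveResistanceStubPlainKuboLink
import Summits.AtomisticToContinuum.FouriersLaw.Theorems.JunctionLocalitySuperadditiveResistanceStubPlainForwardField

/-!
# Stub `stub_evenDoubling` of line `diagonal-split-series-law` is an EQUILIBRIUM statement: its hypothesis-free Kubo form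
(crux `JunctionLocality.SuperadditiveResistance`, stmt-AtomisticToContinuum-11748; helper `--supports` it, lead c19 of line
`diagonal-split-series-law`, 2026-08-17; diagonal analogue of `…KuboReduction` (p127419) for the whole crux)

The registered stub `stub_evenDoubling` of `Cruxes/SuperadditiveResistance/Lines/diagonal_split_series_law.lean` — the crux
ON ITS DIAGONAL, `∃ C ∀ N ≥ 2, 2R_N − C ≤ R_{2N}`, `R_N := (N−1)/D_N` — quantifies, like the crux, over a weak-NESS uniqueness
hypothesis `hU`, a steady-state family `μ`, response coefficients `D` with their `δ → 0` limits and their positivity. Every one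
of these is a THEOREM of the tree at fixed `N` (`JunctionLocality.NessUnique_holds`, `pinnedChain_exists_isSteadyState`,
`finiteResponseOfUnique_proof`, `positiveConductance_proof`), and the finite-volume Kubo formula
`D_L/(L−1) = G_L := γ(1 − (γ/T²)⟨g_L, p_0² − T⟩_{μ_T})` along ANY left forward field `g_L` of the plain `L`-chain is landed
(`stub_plainKuboLink`). Consequently the stub is EQUIVALENT to a statement that mentions no steady state at all — the
**Kubo doubling bound**

  `∀ ω₂ lam β γ T > 0, ∃ C, ∀ N ≥ 2, ∀ forward fields g_N, g_{2N}: 2/G_N − C ≤ 1/G_{2N}`,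

bounded doubling defect of the equilibrium Kubo RESISTANCE `1/G_L` of the pinned anharmonic chain between two Langevin baths
at one temperature `T` — one balanced junction, where the `2N`-chain carries the exact reflection symmetry `i ↦ 2N−1−i`.
This file proves both directions (`kuboDoublingBound_of_evenDoubling`, `evenDoubling_of_kuboDoublingBound`,
`evenDoubling_iff_kuboDoublingBound`). Use: the line's lead, its stub-workers, the crux disprover and the ideation cells may
work on `stub_evenDoubling` with `G_L` only; a refutation of the Kubo form refutes the stub (hence the crux, which contains its
diagonal) and conversely. Both sides are written out (no definition is introduced). Standard axioms; nothing is taken as a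
named fact.
-/

noncomputable section

open MeasureTheory Filter Topology
open scoped ContDiff
open Literature.MathematicalPhysics.KineticTheory.HeatConduction
open Summit.AtomisticToContinuum.FouriersLaw.Cruxes.SuperadditiveResistance.FloatingProbeBypassLaplacian
  (plainKubo plainForwardFields stub_plainKuboLink stub_plainForwardField)
open Summit.AtomisticToContinuum.FouriersLaw.Cruxes.SuperadditiveResistance.ThermaliseThenCutProbeInsertion
  (finiteResponseOfUnique_proof positiveConductance_proof)

namespace Summit.AtomisticToContinuum.FouriersLaw.Cruxes.SuperadditiveResistance.DiagonalSplitSeriesLaw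

/-- **`EvenDoubling` ⇒ Kubo doubling bound.** Feed the stub its own (proved) hypotheses: weak-NESS uniqueness
(`NessUnique_holds`), the canonical steady-state family chosen from `pinnedChain_exists_isSteadyState` (junk `0` at
non-positive temperatures), the response coefficients of `finiteResponseOfUnique_proof` and their positivity
(`positiveConductance_proof`); then convert `(L−1)/D_L` into `1/G_L` by the Kubo link `stub_plainKuboLink` at `L = N, 2N`. -/
theorem kuboDoublingBound_of_evenDoubling
    (h : ∀ ω₂ lam β γ : ℝ, 0 < ω₂ → 0 < lam → 0 < β → 0 < γ → (∀ (N : ℕ) (T_L T_R : ℝ), 0 < T_L → 0 < T_R → ∀ μ ν : MeasureTheory.Measure (Literature.MathematicalPhysics.KineticTheory.HeatConduction.PhaseSpace N), (Literature.MathematicalPhysics.KineticTheory.HeatConduction.pinnedChain ω₂ lam β γ).IsSteadyState N T_L T_R μ → (Literature.MathematicalPhysics.KineticTheory.HeatConduction.pinnedChain ω₂ lam β γ).IsSteadyState N T_L T_R ν → μ = ν) → ∀ μ : (N : ℕ) → ℝ → ℝ → MeasureTheory.Measure (Literature.MathematicalPhysics.KineticTheory.HeatConduction.PhaseSpace N),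 (∀ (N : ℕ) (T_L T_R : ℝ), 0 < T_L → 0 < T_R → (Literature.MathematicalPhysics.KineticTheory.HeatConduction.pinnedChain ω₂ lam β γ).IsSteadyState N T_L T_R (μ N T_L T_R)) → ∀ T : ℝ, 0 < T → ∀ D : ℕ → ℝ, (∀ N : ℕ, Filter.Tendsto (fun δ : ℝ => (Literature.MathematicalPhysics.KineticTheory.HeatConduction.pinnedChain ω₂ lam β γ).totalCurrent (μ N (T + δ / 2) (T - δ / 2)) / δ) (nhdsWithin 0 {(0 : ℝ)}ᶜ) (nhds (D N))) → (∀ N : ℕ, 2 ≤ N → 0 < D N) → ∃ C : ℝ, ∀ N : ℕ, 2 ≤ N → 2 * (((N : ℝ) - 1) / D N) - C ≤ ((N : ℝ) + (N : ℝ) - 1) / D (N + N)) :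
    ∀ ω₂ lam β γ T : ℝ, 0 < ω₂ → 0 < lam → 0 < β → 0 < γ → 0 < T →
      ∃ C : ℝ, ∀ N : ℕ, 2 ≤ N →
        ∀ (gN : PhaseSpace N → ℝ) (gL : PhaseSpace (N + N) → ℝ),
          gN ∈ plainForwardFields ω₂ lam β γ T N → gL ∈ plainForwardFields ω₂ lam β γ T (N + N) →
          2 * (1 / plainKubo ω₂ lam β γ T N gN) - C ≤ 1 / plainKubo ω₂ lam β γ T (N + N) gL := by
  intro ω₂ lam β γ T hω hl hβ hγ hT
  classical
  -- (1) weak-NESS uniqueness is a theorem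
  have hU := Summit.AtomisticToContinuum.FouriersLaw.Theses.JunctionLocality.NessUnique_holds ω₂ lam β γ hω hl hβ hγ
  -- (2) the canonical steady-state family (existence is a theorem; junk outside positive temperatures)
  let μ : (N : ℕ) → ℝ → ℝ → Measure (PhaseSpace N) := fun N a b =>
    if hab : 0 < a ∧ 0 < b then
      Classical.choose (pinnedChain_exists_isSteadyState hω hl hβ hγ N hab.1 hab.2)
    else 0
  have hμ : ∀ (N : ℕ) (a b : ℝ), 0 < a → 0 < b →
      (pinnedChain ω₂ lam β γ).IsSteadyState N a b (μ N a b) := by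
    intro N a b ha hb
    have hab : 0 < a ∧ 0 < b := ⟨ha, hb⟩
    simp only [μ, dif_pos hab]
    exact Classical.choose_spec (pinnedChain_exists_isSteadyState hω hl hβ hγ N hab.1 hab.2)
  -- (3) response coefficients exist and are positive (theorems)
  have hDex := finiteResponseOfUnique_proof ω₂ lam β γ hω hl hβ hγ hU μ hμ T hT
  choose D hD using hDex
  have hpos := positiveConductance_proof ω₂ lam β γ hω hl hβ hγ hU μ hμ T hT D hD
  -- (4) the stub along this data
  obtain ⟨C, hC⟩ := h ω₂ lam β γ hω hl hβ hγ hU μ hμ T hT D hD hpos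
  refine ⟨C, fun N hN gN gL hgN hgL => ?_⟩
  -- (5) Kubo link for the two plain chains
  have kN := stub_plainKuboLink ω₂ lam β γ μ T D hω hl hβ hγ hT hU hμ hD hpos N hN gN hgN
  have kL := stub_plainKuboLink ω₂ lam β γ μ T D hω hl hβ hγ hT hU hμ hD hpos (N + N) (by omega) gL hgL
  have hcast : ((N + N : ℕ) : ℝ) - 1 = (N : ℝ) + (N : ℝ) - 1 := by push_cast; ring
  rw [hcast] at kL
  have rN : 1 / plainKubo ω₂ lam β γ T N gN = ((N : ℝ) - 1) / D N := by rw [← kN, one_div_div]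
  have rL : 1 / plainKubo ω₂ lam β γ T (N + N) gL = ((N : ℝ) + (N : ℝ) - 1) / D (N + N) := by
    rw [← kL, one_div_div]
  rw [rN, rL]
  exact hC N hN

/-- **Kubo doubling bound ⇒ `EvenDoubling`.** Along the stub's own data (`hU`, `μ`, `D`), left forward fields of the plain
`N`- and `2N`-chains exist (`stub_plainForwardField`) and the Kubo link `stub_plainKuboLink` turns `1/G_L` back into
`(L−1)/D_L`. -/
theorem evenDoubling_of_kuboDoublingBound
    (hK : ∀ ω₂ lam β γ T : ℝ, 0 < ω₂ → 0 < lam → 0 < β → 0 < γ → 0 < T →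
      ∃ C : ℝ, ∀ N : ℕ, 2 ≤ N →
        ∀ (gN : PhaseSpace N → ℝ) (gL : PhaseSpace (N + N) → ℝ),
          gN ∈ plainForwardFields ω₂ lam β γ T N → gL ∈ plainForwardFields ω₂ lam β γ T (N + N) →
          2 * (1 / plainKubo ω₂ lam β γ T N gN) - C ≤ 1 / plainKubo ω₂ lam β γ T (N + N) gL) :
    ∀ ω₂ lam β γ : ℝ, 0 < ω₂ → 0 < lam → 0 < β → 0 < γ → (∀ (N : ℕ) (T_L T_R : ℝ), 0 < T_L → 0 < T_R → ∀ μ ν : MeasureTheory.Measure (Literature.MathematicalPhysics.KineticTheory.HeatConduction.PhaseSpace N), (Literature.MathematicalPhysics.KineticTheory.HeatConduction.pinnedChain ω₂ lam β γ).IsSteadyState N T_L T_R μ → (Literature.MathematicalPhysics.KineticTheory.HeatConduction.pinnedChain ω₂ lam β γ).IsSteadyState N T_L T_R ν → μ = ν) → ∀ μ : (N : ℕ) → ℝ → ℝ → MeasureTheory.Measure (Literature.MathematicalPhysics.KineticTheory.HeatConduction.PhaseSpace N), (∀ (N : ℕ) (T_L T_R : ℝ), 0 < T_L → 0 < T_R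 → (Literature.MathematicalPhysics.KineticTheory.HeatConduction.pinnedChain ω₂ lam β γ).IsSteadyState N T_L T_R (μ N T_L T_R)) → ∀ T : ℝ, 0 < T → ∀ D : ℕ → ℝ, (∀ N : ℕ, Filter.Tendsto (fun δ : ℝ => (Literature.MathematicalPhysics.KineticTheory.HeatConduction.pinnedChain ω₂ lam β γ).totalCurrent (μ N (T + δ / 2) (T - δ / 2)) / δ) (nhdsWithin 0 {(0 : ℝ)}ᶜ) (nhds (D N))) → (∀ N : ℕ, 2 ≤ N → 0 < D N) → ∃ C : ℝ, ∀ N : ℕ, 2 ≤ N → 2 * (((N : ℝ) - 1) / D N) - C ≤ ((N : ℝ) + (N : ℝ) - 1) / D (N + N) := by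
  intro ω₂ lam β γ hω hl hβ hγ hU μ hμ T hT D hD hpos
  obtain ⟨C, hC⟩ := hK ω₂ lam β γ T hω hl hβ hγ hT
  refine ⟨C, fun N hN => ?_⟩
  obtain ⟨gN, hgN⟩ := stub_plainForwardField ω₂ lam β γ T hω hl hβ hγ hT N hN
  obtain ⟨gL, hgL⟩ := stub_plainForwardField ω₂ lam β γ T hω hl hβ hγ hT (N + N) (by omega)
  have kN := stub_plainKuboLink ω₂ lam β γ μ T D hω hl hβ hγ hT hU hμ hD hpos N hN gN hgN
  have kL := stub_plainKuboLink ω₂ lam β γ μ T D hω hl hβ hγ hT hU hμ hD hpos (N + N) (by omega) gL hgL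
  have hcast : ((N + N : ℕ) : ℝ) - 1 = (N : ℝ) + (N : ℝ) - 1 := by push_cast; ring
  rw [hcast] at kL
  have rN : ((N : ℝ) - 1) / D N = 1 / plainKubo ω₂ lam β γ T N gN := by rw [← kN, one_div_div]
  have rL : ((N : ℝ) + (N : ℝ) - 1) / D (N + N) = 1 / plainKubo ω₂ lam β γ T (N + N) gL := by
    rw [← kL, one_div_div]
  rw [rN, rL]
  exact hC N hN gN gL hgN hgL

/-- **`stub_evenDoubling` is equivalent to the Kubo doubling bound** — bounded doubling defect of the equilibrium Kubo
resistance `1/G_L`, `G_L = γ(1 − (γ/T²)⟨g_L, p_0² − T⟩_{μ_T})`, of the pinned anharmonic chain between two Langevin baths at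
one temperature `T`: `2/G_N − C ≤ 1/G_{2N}` uniformly in `N ≥ 2`; no steady state, uniqueness hypothesis or response limit
appears on the right. -/
theorem evenDoubling_iff_kuboDoublingBound :
    (∀ ω₂ lam β γ : ℝ, 0 < ω₂ → 0 < lam → 0 < β → 0 < γ → (∀ (N : ℕ) (T_L T_R : ℝ), 0 < T_L → 0 < T_R → ∀ μ ν : MeasureTheory.Measure (Literature.MathematicalPhysics.KineticTheory.HeatConduction.PhaseSpace N), (Literature.MathematicalPhysics.KineticTheory.HeatConduction.pinnedChain ω₂ lam β γ).IsSteadyState N T_L T_R μ → (Literature.MathematicalPhysics.KineticTheory.HeatConduction.pinnedChain ω₂ lam β γ).IsSteadyState N T_L T_R ν → μ = ν) → ∀ μ : (N : ℕ) → ℝ → ℝ → MeasureTheory.Measure (Literature.MathematicalPhysics.KineticTheory.HeatConduction.PhaseSpace N), (∀ (N : ℕ) (T_L T_R : ℝ), 0 < T_L → 0 < T_R → (Literature.MathematicalPhysics.KineticTheory.HeatConduction.pinnedChain ω₂ lam β γ).IsSteadyState N T_L T_R (μ N T_L T_R)) → ∀ T : ℝ, 0 < T → ∀ D : ℕ → ℝ,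 (∀ N : ℕ, Filter.Tendsto (fun δ : ℝ => (Literature.MathematicalPhysics.KineticTheory.HeatConduction.pinnedChain ω₂ lam β γ).totalCurrent (μ N (T + δ / 2) (T - δ / 2)) / δ) (nhdsWithin 0 {(0 : ℝ)}ᶜ) (nhds (D N))) → (∀ N : ℕ, 2 ≤ N → 0 < D N) → ∃ C : ℝ, ∀ N : ℕ, 2 ≤ N → 2 * (((N : ℝ) - 1) / D N) - C ≤ ((N : ℝ) + (N : ℝ) - 1) / D (N + N)) ↔
      ∀ ω₂ lam β γ T : ℝ, 0 < ω₂ → 0 < lam → 0 < β → 0 < γ → 0 < T →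
        ∃ C : ℝ, ∀ N : ℕ, 2 ≤ N →
          ∀ (gN : PhaseSpace N → ℝ) (gL : PhaseSpace (N + N) → ℝ),
            gN ∈ plainForwardFields ω₂ lam β γ T N → gL ∈ plainForwardFields ω₂ lam β γ T (N + N) →
            2 * (1 / plainKubo ω₂ lam β γ T N gN) - C ≤ 1 / plainKubo ω₂ lam β γ T (N + N) gL :=
  ⟨kuboDoublingBound_of_evenDoubling, evenDoubling_of_kuboDoublingBound⟩

end Summit.AtomisticToContinuum.FouriersLaw.Cruxes.SuperadditiveResistance.DiagonalSplitSeriesLaw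

end
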